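import Mathlib
import Literature.Analysis.FluidPDE.AncientAxisymmetricTypeILiouville
import Summits.NavierStokesRegularity.NavierStokesRegularity.Theses.RootDecompFactorLadder

/-!
# RootDecompFactorLadder — BC5 witness (first rung) for the deciding crux `PastIsolatedFactorLiouville`

Writer port (decomp-ns-writer-1 g9) of `decomp-ns-lens-1/g25/PastIsolatedRung.lean` (sha256 fad0d801…20ec, 83 l;
CRITIC-LEDGER row 280 CLEARED KERNEL, optional landing `--supports stmt-NavierStokesRegularity-27744` «no objection»).
DEF-FREE re-typing (writer port rule): the lens's `def PastIsolatedFactorLiouvilleAxisym` and its `_holds` / `_of`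
are replaced by the two binder-shape theorems below (same content; the rung statement is spelled out, not named).

`PastIsolatedFactorLiouville` (B^R, stmt-NavierStokesRegularity-27744, crux rank 2, the declared
residual of `route-NavierStokesRegularity-RootDecompFactorLadder`) asks that every genuinely
rotated (`R ≠ 1` allowed), continuous-representative, future-extended-by-zero, Type I, ancient mild
rotated-DSS field with factor `c > 1` whose factor set is ISOLATED FROM 1 IN THE PAST
(`∃ l > 1`, no RDSS factor in `(1, l)`) vanishes for `t < 0`.

FIRST RUNG in binder shape: the statement restricted to the stratum of fields axisymmetric about one
common axis `A e₃` at every `t < 0` HOLDS (`pastIsolatedFactorLiouville_axisymmetric_rung`), by the landed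
any-axis form of KNSS 2009 Thm 5.3 (`Literature.Analysis.FluidPDE.rotatedTypeIDSSLiouville_of_isAxisymmetric_conj`;
the DSS, the continuity, the future-vanishing and the past-isolation hypotheses are not even used — honest
caveat adopted by the critic: the rung witnesses weakness of the BINDER SHAPE via the Type-I-ancient Liouville
lever, not reach of the isolation mechanism).

Why this is a witness of weakness (BC5 / tribunal T3) and not a case of `S`: the corresponding
`S`-restricted case — global regularity of axisymmetric data WITH SWIRL,
`Summit.NavierStokesRegularity.NavierStokesRegularity.AxisymmetricSwirlRegularity` — is an OPEN
`@[conjecture]` leaf of the tree (no theorem in scope proves it), whereas the crux's axisymmetric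
stratum is a theorem. `pastIsolatedFactorLiouville_axisymmetric_rung_of` records that the rung is
literally a restriction of the crux (one extra, unused hypothesis). Helper only: no item is closed and
Navier–Stokes regularity is NOT proved by anything here.
-/

set_option linter.dupNamespace false

namespace Summit.NavierStokesRegularity.NavierStokesRegularity.Theorems.RootDecompFactorLadderPastIsolatedRung

open MeasureTheory Literature.Analysis.FluidPDE

/-- Binder-shape form usable directly as a `--witness`: the crux's hypotheses, then the axis `A` and
the axisymmetry hypothesis, conclude `u t =ᵐ 0` for `t < 0`. [cite: KochNadirashviliSereginSverak2009, Thm 5.3 and §6] -/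
theorem pastIsolatedFactorLiouville_axisymmetric_rung (c : ℝ)
    (R : EuclideanSpace ℝ (Fin 3) ≃ₗᵢ[ℝ] EuclideanSpace ℝ (Fin 3))
    (u : ℝ → EuclideanSpace ℝ (Fin 3) → EuclideanSpace ℝ (Fin 3)) (_hc : 1 < c)
    (hu : Literature.Analysis.FluidPDE.IsAncientMildSolution 1 u)
    (hmeas : ∀ t : ℝ, t < 0 → MeasureTheory.AEStronglyMeasurable (u t) MeasureTheory.volume)
    (_hcont : ContinuousOn (Function.uncurry u) (Set.Iio 0 ×ˢ Set.univ))
    (_hfut : ∀ t : ℝ, 0 ≤ t → u t = 0)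
    (hdss : Literature.Analysis.FluidPDE.IsRotatedDSS c R u)
    (hdec : ∃ C₀ : ℝ, Literature.Analysis.FluidPDE.HasTypeIDecay C₀ u)
    (_hiso : ∃ l : ℝ, 1 < l ∧ ∀ (c' : ℝ) (R' : EuclideanSpace ℝ (Fin 3) ≃ₗᵢ[ℝ] EuclideanSpace ℝ (Fin 3)),
      1 < c' → c' < l → ¬ Literature.Analysis.FluidPDE.IsRotatedDSS c' R' u)
    (A : EuclideanSpace ℝ (Fin 3) ≃ₗᵢ[ℝ] EuclideanSpace ℝ (Fin 3))
    (haxi : ∀ t : ℝ, t < 0 → Literature.Analysis.FluidPDE.IsAxisymmetric (fun x => A.symm (u t (A x)))) :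
    ∀ t : ℝ, t < 0 → u t =ᵐ[MeasureTheory.volume] 0 :=
  rotatedTypeIDSSLiouville_of_isAxisymmetric_conj c R u hu hmeas hdss hdec A haxi

/-- The rung is a literal restriction of the crux: `PastIsolatedFactorLiouville` (stmt-27744) gives the
same conclusion with the axis hypothesis simply ignored (def-free form of the lens's `_of`). -/
theorem pastIsolatedFactorLiouville_axisymmetric_rung_of
    (h : Theses.RootDecompFactorLadder.PastIsolatedFactorLiouville) (c : ℝ)
    (R : EuclideanSpace ℝ (Fin 3) ≃ₗᵢ[ℝ] EuclideanSpace ℝ (Fin 3))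
    (u : ℝ → EuclideanSpace ℝ (Fin 3) → EuclideanSpace ℝ (Fin 3)) (hc : 1 < c)
    (hu : Literature.Analysis.FluidPDE.IsAncientMildSolution 1 u)
    (hmeas : ∀ t : ℝ, t < 0 → MeasureTheory.AEStronglyMeasurable (u t) MeasureTheory.volume)
    (hcont : ContinuousOn (Function.uncurry u) (Set.Iio 0 ×ˢ Set.univ))
    (hfut : ∀ t : ℝ, 0 ≤ t → u t = 0)
    (hdss : Literature.Analysis.FluidPDE.IsRotatedDSS c R u)
    (hdec : ∃ C₀ : ℝ, Literature.Analysis.FluidPDE.HasTypeIDecay C₀ u)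
    (hiso : ∃ l : ℝ, 1 < l ∧ ∀ (c' : ℝ) (R' : EuclideanSpace ℝ (Fin 3) ≃ₗᵢ[ℝ] EuclideanSpace ℝ (Fin 3)),
      1 < c' → c' < l → ¬ Literature.Analysis.FluidPDE.IsRotatedDSS c' R' u)
    (A : EuclideanSpace ℝ (Fin 3) ≃ₗᵢ[ℝ] EuclideanSpace ℝ (Fin 3))
    (_haxi : ∀ t : ℝ, t < 0 → Literature.Analysis.FluidPDE.IsAxisymmetric (fun x => A.symm (u t (A x)))) :
    ∀ t : ℝ, t < 0 → u t =ᵐ[MeasureTheory.volume] 0 :=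
  h c R u hc hu hmeas hcont hfut hdss hdec hiso

end Summit.NavierStokesRegularity.NavierStokesRegularity.Theorems.RootDecompFactorLadderPastIsolatedRung
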